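import Summits.HubbardSuperconductivity.HubbardSuperconductivity.Theorems.AnisotropyChordTransferFibre3FinXDCheck

/-!
# Route `AnisotropyChord` / H0 rotor rung: FIN per-`L` row-D (KT-2a″) SUB-CELL facts, `L = 9` (24–29)

Row-D facts `xdCellAny0 9 (49/50) la lb aD = true` on quarter sub-cells of the combined cells whose side condition needs `aD ≈ .04` (mechhunt STATUS p3 g7 REPORT 3).
Prover seat `hubbard-h0-rotor-p3` g7; helper for piece A = stmt-HubbardSuperconductivity-23918 of rung 19089 (`--supports`, helper class).
WHAT THIS IS NOT: nothing here proves superconductivity in the Hubbard model (rotor TARGET as worded stays FALSE, g15 verdict); kernel facts /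
assembly for ONE conditional reduction at one `L`.  No sorry.
-/

set_option linter.dupNamespace false
set_option autoImplicit false

namespace Summit.HubbardSuperconductivity.HubbardSuperconductivity.Theorems.AnisotropyChord.Transfer.Fibre3

namespace FinXD

/-- row-D sub-cell `[11872432903729661, 11946635609377971]` of `L = 9`. [folklore] -/
theorem xd9s_115_0 : xdCellAny0 9 (49/50 : ℚ) 11872432903729661 11946635609377971 (1/25 : ℚ) = true := by decide +kernel

/-- row-D sub-cell `[11946635609377971, 12020838315026281]` of `L = 9`. [folklore] -/
theorem xd9s_115_1 : xdCellAny0 9 (49/50 : ℚ) 11946635609377971 12020838315026281 (1/25 : ℚ) = true := by decide +kernel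

/-- row-D sub-cell `[12020838315026281, 12095041020674591]` of `L = 9`. [folklore] -/
theorem xd9s_115_2 : xdCellAny0 9 (49/50 : ℚ) 12020838315026281 12095041020674591 (1/25 : ℚ) = true := by decide +kernel

/-- row-D sub-cell `[12095041020674591, 12169243726322901]` of `L = 9`. [folklore] -/
theorem xd9s_115_3 : xdCellAny0 9 (49/50 : ℚ) 12095041020674591 12169243726322901 (1/25 : ℚ) = true := by decide +kernel

/-- row-D sub-cell `[12785311689967997, 12865219888030296]` of `L = 9`. [folklore] -/
theorem xd9s_118_0 : xdCellAny0 9 (49/50 : ℚ) 12785311689967997 12865219888030296 (1/25 : ℚ) = true := by decide +kernel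

/-- row-D sub-cell `[12865219888030296, 12945128086092596]` of `L = 9`. [folklore] -/
theorem xd9s_118_1 : xdCellAny0 9 (49/50 : ℚ) 12865219888030296 12945128086092596 (1/25 : ℚ) = true := by decide +kernel

end FinXD

end Summit.HubbardSuperconductivity.HubbardSuperconductivity.Theorems.AnisotropyChord.Transfer.Fibre3
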